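import Summits.HubbardSuperconductivity.HubbardSuperconductivity.Theorems.ChiralWindowCwThesisSectorGroundStateRestrict
import Summits.HubbardSuperconductivity.HubbardSuperconductivity.Theorems.BalabanIRBirGroundStateAverageLRO
import HarnessLib

/-!
# Route `LogColdTorus`, crux `AverageToEvery` (item `stmt-HubbardSuperconductivity-10519`): the block
ground-state functional IS the sector ground-projector trace average (BLOCK ↔ FOCK dictionary for averages)

Helpers (`--supports`) for the crux
`Summit.HubbardSuperconductivity.HubbardSuperconductivity.Theses.LogColdTorus.AverageToEvery`, whose
window hypothesis is written in BLOCK form — `Matrix.groundStateFunctional` of the compression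
`H.toBlock p p` of the torus Hubbard Hamiltonian to an occupation block `p` — while the sibling hub
`BalabanIR.BirEveryGroundState` and all its landed closers (`hubbardSuperconductivity_of_shiftedAverage`,
`…_of_penalisedThermalAverage`, `exists_unit_le_re_of_trace_projMatrix_map`, …) speak the FOCK form
`(tr P)⁻¹ tr (P O)` with `P` the projection matrix onto the sector ground eigenspace
`E₀ = K ⊓ ker (A - e₀)`, `e₀ = minEnergyOn A K`. This file proves that the two are THE SAME NUMBER:

* `trace_toBlock_of_row_support`, `trace_toBlock_mul_toBlock_of_support` — traces of compressions of
  matrices supported on the block;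
* `projMatrix_apply_eq_zero_of_not_left` / `_right` — the projection matrix onto a subspace of the
  coordinate subspace of `p` vanishes outside the `p × p` block;
* `restrict_mem_groundSpace_toBlock`, `extend_mem_groundEigenspace` — restriction / extension by zero
  identify the sector ground eigenspace `E₀` with the ground space of the block `A.toBlock p p`
  (block ground energy = sector energy, `CwThesis.groundEnergy_toBlock_eq_minEnergyOn`);
* `groundProj_toBlock_eq` — hence the ground projection of the block is the compression of the
  Fock-side projector (`proj_unique`);
* `groundStateFunctional_toBlock_eq_traceAverage` — **for a Hermitian `A` with no matrix entries
  from the block to its complement, a non-empty decidable block `p` with coordinate subspace `K`, and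
  any observable `O`: `(A.toBlock p p).groundStateFunctional (O.toBlock p p) = (tr P)⁻¹ * tr (P O)`.**
* `groundStateFunctional_toBlock_eq_traceAverage_of_preservesSectors`,
  `hubbardTorus_groundStateFunctional_toBlock_eq_traceAverage` — the torus specialisation: for
  `n ≤ L²` the `(2n, S^z = 0)` occupation block of the crux (`#s = 2n ∧ 2·#{↑ ∈ s} = 2n`) and the
  sector `szSector (2n) 0`; in particular the window hypothesis of `AverageToEvery` at `(U, L)` is
  VERBATIM the ground-projector average bound of `BalabanIR.BirEveryGroundState` at `(U, L)`;
  `hubbardTorus_blockGroundStateFunctional_eq_traceAverage` is the same identity elaborated with the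
  route file's classical instances (the form that rewrites the crux hypothesis by `rw`).

Everything is finite-dimensional linear algebra (Tasaki, *Physics and Mathematics of Quantum
Many-Body Systems* (2020) §2.1–2.2, App. A.2). Folklore; no definition is introduced.
-/

noncomputable section

-- `dupNamespace`: the summit and the problem are both named `HubbardSuperconductivity` (layout D-0022)
set_option linter.dupNamespace false
-- the `(n,n)`-sector index type `{s : Finset (Orb Λ) // …}` needs a larger instance budget for
-- `DecidableEq` (structural instance through `Lex (Fin 2 → Fin L)`; tree precedent: CwThesisBlockGroundEnergy)
set_option synthInstance.maxSize 512

namespace Summit.HubbardSuperconductivity.HubbardSuperconductivity.Theorems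

open Matrix Finset
open Literature.MathematicalPhysics.QuantumLattice
open Literature.Computability.AlgebraicComplexity (proj_unique)
open scoped ComplexOrder

section Generic

variable {ι : Type*} [Fintype ι] [DecidableEq ι]

/-! ### Traces of compressions of block-supported matrices -/

omit [DecidableEq ι] in
/-- If the rows of `M` outside `p` vanish, the trace of the compression `M.toBlock p p` is the trace
of `M`. [folklore] -/
theorem trace_toBlock_of_row_support (M : Matrix ι ι ℂ) (p : ι → Prop) [DecidablePred p]
    (hrow : ∀ i j, ¬ p i → M i j = 0) : (M.toBlock p p).trace = M.trace := by
  simp only [Matrix.trace, Matrix.diag_apply]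
  rw [sum_eq_sum_subtype_of_support p (fun i => M i i) fun i hi => hrow i i hi]
  rfl

omit [DecidableEq ι] in
/-- If `M` vanishes outside the `p × p` block, then for every `O` the trace of the product of the
compressions is the trace of the product: `tr (M_p O_p) = tr (M O)`. [folklore] -/
theorem trace_toBlock_mul_toBlock_of_support (M O : Matrix ι ι ℂ) (p : ι → Prop) [DecidablePred p]
    (hrow : ∀ i j, ¬ p i → M i j = 0) (hcol : ∀ i j, ¬ p j → M i j = 0) :
    (M.toBlock p p * O.toBlock p p).trace = (M * O).trace := by
  simp only [Matrix.trace, Matrix.diag_apply]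
  rw [sum_eq_sum_subtype_of_support p (fun i => (M * O) i i) fun i hi => by
    rw [Matrix.mul_apply]
    exact Finset.sum_eq_zero fun j _ => by rw [hrow i j hi, zero_mul]]
  refine Finset.sum_congr rfl fun a _ => ?_
  rw [Matrix.mul_apply, Matrix.mul_apply,
    sum_eq_sum_subtype_of_support p (fun j => M a.1 j * O j a.1) fun j hj => by
      rw [hcol a.1 j hj, zero_mul]]
  rfl

/-! ### The projector onto a subspace of a coordinate subspace lives on the block -/

/-- The projection matrix onto (the transport of) a subspace `E` of the coordinate subspace of `p`
has vanishing ROWS outside `p`: `P i j = (P e_j) i = 0` for `¬ p i`, since `P e_j ∈ E`. [folklore] -/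
theorem projMatrix_apply_eq_zero_of_not_left (E : Submodule ℂ (ι → ℂ)) (p : ι → Prop)
    (hE : ∀ v ∈ E, ∀ i, ¬ p i → v i = 0) {i : ι} (hi : ¬ p i) (j : ι) :
    projMatrix (E.map ((WithLp.linearEquiv 2 ℂ (ι → ℂ)).symm : (ι → ℂ) →ₗ[ℂ] EuclideanSpace ℂ ι))
      i j = 0 := by
  have h := hE _ (projMatrix_map_mulVec_mem E (Pi.single j 1)) i hi
  rwa [Matrix.mulVec_single_one] at h

/-- … and vanishing COLUMNS outside `p` (it is Hermitian). [folklore] -/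
theorem projMatrix_apply_eq_zero_of_not_right (E : Submodule ℂ (ι → ℂ)) (p : ι → Prop)
    (hE : ∀ v ∈ E, ∀ i, ¬ p i → v i = 0) (i : ι) {j : ι} (hj : ¬ p j) :
    projMatrix (E.map ((WithLp.linearEquiv 2 ℂ (ι → ℂ)).symm : (ι → ℂ) →ₗ[ℂ] EuclideanSpace ℂ ι))
      i j = 0 := by
  have hH := projMatrix_isHermitian
    (E.map ((WithLp.linearEquiv 2 ℂ (ι → ℂ)).symm : (ι → ℂ) →ₗ[ℂ] EuclideanSpace ℂ ι))
  have h := projMatrix_apply_eq_zero_of_not_left E p hE hj i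
  have h2 := congrFun (congrFun hH.eq i) j
  rw [Matrix.conjTranspose_apply, h, star_zero] at h2
  exact h2.symm

/-! ### The sector ground eigenspace and the ground space of the block -/

/-- **Restriction maps the sector ground eigenspace into the ground space of the block.** For a
Hermitian `A`, a non-empty decidable block `p` with coordinate subspace `K`, and
`E₀ = K ⊓ ker (A - e₀)`, `e₀ = minEnergyOn A K`: the restriction to `{i // p i}` of `v ∈ E₀` is a
ground vector of `A.toBlock p p` (`A_p (res v) = res (A v) = e₀ res v`, and `e₀` is the block ground
energy, `CwThesis.groundEnergy_toBlock_eq_minEnergyOn`). Tasaki (2020) §2.1–2.2. [folklore] -/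
theorem restrict_mem_groundSpace_toBlock (A : Matrix ι ι ℂ) (hA : A.IsHermitian) (p : ι → Prop)
    [DecidablePred p] [Nonempty {i // p i}] (K : Submodule ℂ (ι → ℂ))
    (hK : ∀ v, v ∈ K ↔ ∀ i, ¬ p i → v i = 0) {v : ι → ℂ}
    (hv : v ∈ K ⊓ Module.End.eigenspace (Matrix.toLin' A) ((A.minEnergyOn K : ℝ) : ℂ)) :
    (fun a : {i // p i} => v a.1) ∈ (A.toBlock p p).groundSpace := by
  obtain ⟨hvK, hvE⟩ := Submodule.mem_inf.mp hv
  rw [Module.End.mem_eigenspace_iff, Matrix.toLin'_apply] at hvE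
  have hsupp : ∀ i, ¬ p i → v i = 0 := (hK v).1 hvK
  rw [Matrix.mem_groundSpace_iff, CwThesis.groundEnergy_toBlock_eq_minEnergyOn A hA p K hK,
    CwThesis.toBlock_mulVec_restrict_of_support p A v hsupp, hvE]
  rfl

/-- **Extension by zero maps the ground space of the block into the sector ground eigenspace**,
provided `A` has no matrix entries from the block to its complement (`A i j = 0` for `¬ p i`,
`p j`): the extension `ext φ` lies in `K`, and `A (ext φ)` restricts to `A_p φ = e₀ φ` on the block
and vanishes off it. Tasaki (2020) §2.1–2.2. [folklore] -/
theorem extend_mem_groundEigenspace (A : Matrix ι ι ℂ) (hA : A.IsHermitian) (p : ι → Prop)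
    [DecidablePred p] [Nonempty {i // p i}] (hinv : ∀ i j, ¬ p i → p j → A i j = 0)
    (K : Submodule ℂ (ι → ℂ)) (hK : ∀ v, v ∈ K ↔ ∀ i, ¬ p i → v i = 0)
    {φ : {i // p i} → ℂ} (hφ : φ ∈ (A.toBlock p p).groundSpace) :
    (fun i => if h : p i then φ ⟨i, h⟩ else 0) ∈
      K ⊓ Module.End.eigenspace (Matrix.toLin' A) ((A.minEnergyOn K : ℝ) : ℂ) := by
  set ψ : ι → ℂ := fun i => if h : p i then φ ⟨i, h⟩ else 0 with hψ
  have hψ_apply : ∀ a : {i // p i}, ψ a.1 = φ a := fun a => by simp [hψ, a.2]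
  have hψ_not : ∀ i, ¬ p i → ψ i = 0 := fun i hi => by simp [hψ, hi]
  have hres : (fun a : {i // p i} => ψ a.1) = φ := funext hψ_apply
  rw [Matrix.mem_groundSpace_iff, CwThesis.groundEnergy_toBlock_eq_minEnergyOn A hA p K hK] at hφ
  refine Submodule.mem_inf.mpr ⟨(hK ψ).2 hψ_not, ?_⟩
  rw [Module.End.mem_eigenspace_iff, Matrix.toLin'_apply]
  funext i
  by_cases hi : p i
  · have h1 : (A *ᵥ ψ) i = (A.toBlock p p *ᵥ fun a : {i // p i} => ψ a.1) ⟨i, hi⟩ := by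
      rw [CwThesis.toBlock_mulVec_restrict_of_support p A ψ hψ_not]
    rw [h1, hres, hφ, Pi.smul_apply, Pi.smul_apply, ← hψ_apply ⟨i, hi⟩]
  · have h2 : (A *ᵥ ψ) i = 0 := by
      rw [Matrix.mulVec, dotProduct]
      refine Finset.sum_eq_zero fun j _ => ?_
      by_cases hj : p j
      · rw [hinv i j hi hj, zero_mul]
      · rw [hψ_not j hj, mul_zero]
    rw [h2, Pi.smul_apply, hψ_not i hi, smul_zero]

/-- **The ground projection of the block is the compression of the sector ground projector.** For a
Hermitian `A` with no entries from the block `p` to its complement, `p` non-empty with coordinate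
subspace `K`, `E₀ = K ⊓ ker (A - e₀)` and `P` the projection matrix onto (the Euclidean transport of)
`E₀`: `(A.toBlock p p).groundProj = P.toBlock p p` — both are Hermitian, fix the block ground space
pointwise and map into it (`proj_unique`). Tasaki (2020) App. A.2. [folklore] -/
theorem groundProj_toBlock_eq (A : Matrix ι ι ℂ) (hA : A.IsHermitian) (p : ι → Prop)
    [DecidablePred p] [Nonempty {i // p i}] (hinv : ∀ i j, ¬ p i → p j → A i j = 0)
    (K : Submodule ℂ (ι → ℂ)) (hK : ∀ v, v ∈ K ↔ ∀ i, ¬ p i → v i = 0) :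
    (A.toBlock p p).groundProj =
      (projMatrix ((K ⊓ Module.End.eigenspace (Matrix.toLin' A) ((A.minEnergyOn K : ℝ) : ℂ)).map
        ((WithLp.linearEquiv 2 ℂ (ι → ℂ)).symm : (ι → ℂ) →ₗ[ℂ] EuclideanSpace ℂ ι))).toBlock p p := by
  set E₀ := K ⊓ Module.End.eigenspace (Matrix.toLin' A) ((A.minEnergyOn K : ℝ) : ℂ) with hE₀
  set P := projMatrix (E₀.map
    ((WithLp.linearEquiv 2 ℂ (ι → ℂ)).symm : (ι → ℂ) →ₗ[ℂ] EuclideanSpace ℂ ι)) with hP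
  have hE₀K : ∀ v ∈ E₀, ∀ i, ¬ p i → v i = 0 := fun v hv => (hK v).1 (Submodule.mem_inf.mp hv).1
  -- extension by zero and restriction
  set ext : ({i // p i} → ℂ) → (ι → ℂ) := fun φ i => if h : p i then φ ⟨i, h⟩ else 0 with hext
  have hext_apply : ∀ φ (a : {i // p i}), ext φ a.1 = φ a := fun φ a => by simp [hext, a.2]
  have hext_not : ∀ φ i, ¬ p i → ext φ i = 0 := fun φ i hi => by simp [hext, hi]
  have hres_ext : ∀ φ, (fun a : {i // p i} => ext φ a.1) = φ := fun φ => funext (hext_apply φ)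
  -- the compression of `P` acts as `res ∘ P ∘ ext`
  have hPB : ∀ φ : {i // p i} → ℂ, P.toBlock p p *ᵥ φ = fun a : {i // p i} => (P *ᵥ ext φ) a.1 := by
    intro φ
    conv_lhs => rw [← hres_ext φ]
    exact CwThesis.toBlock_mulVec_restrict_of_support p P (ext φ) (hext_not φ)
  symm
  refine proj_unique ((projMatrix_isHermitian _).submatrix _) (Matrix.groundProj_isHermitian _)
    (fun w hw => ?_) (fun φ => ?_) (fun w hw => Matrix.groundProj_mulVec_of_mem _ hw)
    (fun φ => Matrix.groundProj_mulVec_mem _ φ)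
  · -- `P_p` fixes the block ground space: `ext w ∈ E₀` is fixed by `P`
    have hmem : ext w ∈ E₀ := extend_mem_groundEigenspace A hA p hinv K hK hw
    rw [hPB, projMatrix_map_mulVec_of_mem E₀ hmem, hres_ext]
  · -- `P_p` maps into the block ground space: `P (ext φ) ∈ E₀` restricts to a block ground vector
    rw [hPB]
    exact restrict_mem_groundSpace_toBlock A hA p K hK (projMatrix_map_mulVec_mem E₀ (ext φ))

/-- **Block ground-state functional = sector ground-projector trace average.** For a Hermitian `A`
with no matrix entries from the block `p` to its complement (`A i j = 0` for `¬ p i`, `p j` — e.g. a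
Hamiltonian conserving the quantum numbers defining the block), `p` a non-empty decidable predicate
with coordinate subspace `K`, `E₀ = K ⊓ ker (A - e₀)` (`e₀ = minEnergyOn A K`), `P` the projection
matrix onto (the Euclidean transport of) `E₀`, and ANY observable `O`:
`(A.toBlock p p).groundStateFunctional (O.toBlock p p) = (tr P)⁻¹ * tr (P O)` — the tracial
ground-state average of the compressed observable in the compressed Hamiltonian equals the Fock-side
ground-projector average (`groundProj_toBlock_eq` and the trace identities for block-supported
matrices). This is the dictionary between the BLOCK vocabulary of routes `LogColdTorus` /
`AbelianDuality` and the PROJECTOR vocabulary of route `BalabanIR`. Tasaki (2020) §2.1, App. A.2.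
[folklore] -/
theorem groundStateFunctional_toBlock_eq_traceAverage (A : Matrix ι ι ℂ) (hA : A.IsHermitian)
    (p : ι → Prop) [DecidablePred p] [Nonempty {i // p i}]
    (hinv : ∀ i j, ¬ p i → p j → A i j = 0)
    (K : Submodule ℂ (ι → ℂ)) (hK : ∀ v, v ∈ K ↔ ∀ i, ¬ p i → v i = 0) (O : Matrix ι ι ℂ) :
    (A.toBlock p p).groundStateFunctional (O.toBlock p p) =
      ((projMatrix ((K ⊓ Module.End.eigenspace (Matrix.toLin' A) ((A.minEnergyOn K : ℝ) : ℂ)).map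
        ((WithLp.linearEquiv 2 ℂ (ι → ℂ)).symm : (ι → ℂ) →ₗ[ℂ] EuclideanSpace ℂ ι))).trace)⁻¹ *
      (projMatrix ((K ⊓ Module.End.eigenspace (Matrix.toLin' A) ((A.minEnergyOn K : ℝ) : ℂ)).map
        ((WithLp.linearEquiv 2 ℂ (ι → ℂ)).symm : (ι → ℂ) →ₗ[ℂ] EuclideanSpace ℂ ι)) * O).trace := by
  set E₀ := K ⊓ Module.End.eigenspace (Matrix.toLin' A) ((A.minEnergyOn K : ℝ) : ℂ) with hE₀
  have hE₀K : ∀ v ∈ E₀, ∀ i, ¬ p i → v i = 0 := fun v hv => (hK v).1 (Submodule.mem_inf.mp hv).1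
  have hrow := fun i j (hi : ¬ p i) => projMatrix_apply_eq_zero_of_not_left E₀ p hE₀K hi j
  have hcol := fun i j (hj : ¬ p j) => projMatrix_apply_eq_zero_of_not_right E₀ p hE₀K i hj
  rw [Matrix.groundStateFunctional_apply, groundProj_toBlock_eq A hA p hinv K hK,
    trace_toBlock_of_row_support _ p hrow, trace_toBlock_mul_toBlock_of_support _ O p hrow hcol]

end Generic

section Torus

open Literature.Probability.LatticeModels

/-- The number of up electrons of a configuration as a filtered count (`x ↦ (x, ↑)` is a bijection
from `upPart s` onto `{i ∈ s | spin i = 0}`). Lieb, PRL 62 (1989) 1201, proof of Thm 1. [folklore] -/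
private theorem card_upPart_eq_card_filter_spin {Λ : Type*} [LinearOrder Λ] [Fintype Λ]
    (s : Finset (Orb Λ)) : (upPart s).card = (s.filter fun i => (ofLex i).2 = 0).card := by
  -- adapted from `JosephsonMirror.card_upPart_eq_card_filter`
  rw [show (s.filter fun i => (ofLex i).2 = 0) = (upPart s).image (fun x => orb x 0) from ?_,
    Finset.card_image_of_injective _ (fun x y h => (orb_inj.1 h).1)]
  ext i
  simp only [Finset.mem_filter, Finset.mem_image, mem_upPart]
  constructor
  · rintro ⟨hi, h0⟩
    refine ⟨(ofLex i).1, ?_, ?_⟩ <;>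
    · have : orb (ofLex i).1 0 = i := by rw [← h0]; exact toLex_ofLex i
      simp [this, hi]
  · rintro ⟨x, hx, rfl⟩
    exact ⟨hx, rfl⟩

/-- The occupation-block predicate of the crux (`#s = 2n`, `2·#{↑ ∈ s} = 2n`) is Lieb's `(n, n)`
sector condition. [folklore] -/
private theorem blockPred_iff {Λ : Type*} [LinearOrder Λ] [Fintype Λ] (n : ℕ) (s : Finset (Orb Λ)) :
    (s.card = 2 * n ∧ 2 * (s.filter fun i => (ofLex i).2 = 0).card = 2 * n) ↔
      ((upPart s).card = n ∧ (downPart s).card = n) := by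
  rw [card_eq_upPart_add_downPart s, ← card_upPart_eq_card_filter_spin s]
  omega

/-- **Block ground-state functional = sector ground-projector average, for sector-preserving
Hamiltonians on the torus Fock space.** On the fermionic Fock space of the torus of side `L`, for
`n ≤ L²`, a Hermitian `H` conserving `(N↑, N↓)` (`PreservesSectors H`) and any observable `O`: the
tracial ground-state functional of the compression of `H` to the occupation block
`p s := (#s = 2n ∧ 2·#{↑ ∈ s} = 2n)` evaluated on the compression of `O` equals `(tr P)⁻¹ tr (P O)`,
`P` the projection matrix onto the sector ground eigenspace
`E₀ = szSector (2n) 0 ⊓ ker (H - minEnergyOn H (szSector (2n) 0))` (`szSector (2n) 0` is the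
coordinate subspace of the block, `mem_szSector_two_mul_zero_iff`; the block is non-empty for
`n ≤ L²`). Tasaki (2020) §2.1–2.2; Lieb, PRL 62 (1989) 1201. [folklore] -/
theorem groundStateFunctional_toBlock_eq_traceAverage_of_preservesSectors (L : ℕ) {n : ℕ}
    (hn : n ≤ L ^ 2)
    (H O : Matrix (Finset (Orb (FermionTorus 2 L))) (Finset (Orb (FermionTorus 2 L))) ℂ)
    (hH : H.IsHermitian) (hpres : PreservesSectors H) :
    (H.toBlock (fun s : Finset (Orb (FermionTorus 2 L)) => s.card = 2 * n ∧
          2 * (s.filter fun i => (ofLex i).2 = 0).card = 2 * n)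
        (fun s : Finset (Orb (FermionTorus 2 L)) => s.card = 2 * n ∧
          2 * (s.filter fun i => (ofLex i).2 = 0).card = 2 * n)).groundStateFunctional
      (O.toBlock (fun s : Finset (Orb (FermionTorus 2 L)) => s.card = 2 * n ∧
          2 * (s.filter fun i => (ofLex i).2 = 0).card = 2 * n)
        (fun s : Finset (Orb (FermionTorus 2 L)) => s.card = 2 * n ∧
          2 * (s.filter fun i => (ofLex i).2 = 0).card = 2 * n)) =
      ((projMatrix ((szSector (2 * n) 0 ⊓ Module.End.eigenspace (Matrix.toLin' H)
          (((H.minEnergyOn (szSector (2 * n) 0)) : ℝ) : ℂ)).map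
          (Fock.toEuclidean (ι := Orb (FermionTorus 2 L)) :
            Fock (Orb (FermionTorus 2 L)) →ₗ[ℂ] EuclideanSpace ℂ (Finset (Orb (FermionTorus 2 L)))))).trace)⁻¹ *
      (projMatrix ((szSector (2 * n) 0 ⊓ Module.End.eigenspace (Matrix.toLin' H)
          (((H.minEnergyOn (szSector (2 * n) 0)) : ℝ) : ℂ)).map
          (Fock.toEuclidean (ι := Orb (FermionTorus 2 L)) :
            Fock (Orb (FermionTorus 2 L)) →ₗ[ℂ] EuclideanSpace ℂ (Finset (Orb (FermionTorus 2 L))))) *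
        O).trace := by
  -- the block is non-empty: `pairSet α α` for an `n`-subset `α` of the `L²` sites
  have hcard : Fintype.card (FermionTorus 2 L) = L ^ 2 := by
    change Fintype.card (Fin 2 → Fin L) = L ^ 2
    rw [Fintype.card_fun, Fintype.card_fin, Fintype.card_fin]
  obtain ⟨α, -, hα⟩ := Finset.exists_subset_card_eq (s := (Finset.univ : Finset (FermionTorus 2 L)))
    (n := n) (by rw [Finset.card_univ, hcard]; exact hn)
  haveI : Nonempty {s : Finset (Orb (FermionTorus 2 L)) // s.card = 2 * n ∧
      2 * (s.filter fun i => (ofLex i).2 = 0).card = 2 * n} :=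
    ⟨⟨pairSet α α, (blockPred_iff n _).2 ⟨by rw [upPart_pairSet, hα], by rw [downPart_pairSet, hα]⟩⟩⟩
  -- `H` has no entries from the block to its complement
  have hinv : ∀ s s' : Finset (Orb (FermionTorus 2 L)),
      ¬ (s.card = 2 * n ∧ 2 * (s.filter fun i => (ofLex i).2 = 0).card = 2 * n) →
      (s'.card = 2 * n ∧ 2 * (s'.filter fun i => (ofLex i).2 = 0).card = 2 * n) → H s s' = 0 := by
    intro s s' hs hs'
    by_contra h
    have hss := hpres s s' h
    have hs'' := (blockPred_iff n s').1 hs'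
    exact hs ((blockPred_iff n s).2 ⟨hss.1.trans hs''.1, hss.2.trans hs''.2⟩)
  -- the joint sector is the coordinate subspace of the block
  have hK : ∀ v : Fock (Orb (FermionTorus 2 L)), v ∈ szSector (2 * n) (0 : ℝ) ↔
      ∀ s, ¬ (s.card = 2 * n ∧ 2 * (s.filter fun i => (ofLex i).2 = 0).card = 2 * n) → v s = 0 := by
    intro v
    rw [mem_szSector_two_mul_zero_iff n v]
    exact forall_congr' fun s => by rw [blockPred_iff n s]
  exact groundStateFunctional_toBlock_eq_traceAverage H hH _ hinv (szSector (2 * n) 0) hK O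

/-- **The crux's block vocabulary = the projector vocabulary, for the torus Hubbard Hamiltonian.**
For `n ≤ L²`, any `t, U` and any observable `O`, the tracial ground-state functional of the
compression of `hubbardTorus 2 L t U` to the `(2n, S^z = 0)` occupation block, evaluated on the
compression of `O` — the quantity in the window hypothesis of `LogColdTorus.AverageToEvery` /
`AbelianDuality` (`O = Δ_d† Δ_d`, `n = ⌊(1-δ)L²/2⌋`, `t = 1`) — equals `(tr P)⁻¹ tr (P O)` with `P`
the projection matrix onto the sector ground eigenspace `E₀(U, L)` — the quantity in the hypothesis
of `BalabanIR.BirEveryGroundState` and of the landed closers of that route. Lieb, PRL 62 (1989)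
1201; Tasaki (2020) §2.1. [folklore] -/
theorem hubbardTorus_groundStateFunctional_toBlock_eq_traceAverage :
    ∀ (L : ℕ) (t U : ℝ) (n : ℕ), n ≤ L ^ 2 →
    ∀ (O : Matrix (Finset (Orb (FermionTorus 2 L))) (Finset (Orb (FermionTorus 2 L))) ℂ),
    ((hubbardTorus 2 L t U).toBlock (fun s : Finset (Orb (FermionTorus 2 L)) => s.card = 2 * n ∧
          2 * (s.filter fun i => (ofLex i).2 = 0).card = 2 * n)
        (fun s : Finset (Orb (FermionTorus 2 L)) => s.card = 2 * n ∧
          2 * (s.filter fun i => (ofLex i).2 = 0).card = 2 * n)).groundStateFunctional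
      (O.toBlock (fun s : Finset (Orb (FermionTorus 2 L)) => s.card = 2 * n ∧
          2 * (s.filter fun i => (ofLex i).2 = 0).card = 2 * n)
        (fun s : Finset (Orb (FermionTorus 2 L)) => s.card = 2 * n ∧
          2 * (s.filter fun i => (ofLex i).2 = 0).card = 2 * n)) =
      ((projMatrix ((szSector (2 * n) 0 ⊓ Module.End.eigenspace (Matrix.toLin' (hubbardTorus 2 L t U))
          ((((hubbardTorus 2 L t U).minEnergyOn (szSector (2 * n) 0)) : ℝ) : ℂ)).map
          (Fock.toEuclidean (ι := Orb (FermionTorus 2 L)) :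
            Fock (Orb (FermionTorus 2 L)) →ₗ[ℂ] EuclideanSpace ℂ (Finset (Orb (FermionTorus 2 L)))))).trace)⁻¹ *
      (projMatrix ((szSector (2 * n) 0 ⊓ Module.End.eigenspace (Matrix.toLin' (hubbardTorus 2 L t U))
          ((((hubbardTorus 2 L t U).minEnergyOn (szSector (2 * n) 0)) : ℝ) : ℂ)).map
          (Fock.toEuclidean (ι := Orb (FermionTorus 2 L)) :
            Fock (Orb (FermionTorus 2 L)) →ₗ[ℂ] EuclideanSpace ℂ (Finset (Orb (FermionTorus 2 L))))) *
        O).trace := by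
  intro L t U n hn O
  exact groundStateFunctional_toBlock_eq_traceAverage_of_preservesSectors L hn _ O
    (hubbardTorus_isHermitian (hamiltonian_isHermitian_and_commute_holds _) t U)
    (LiebThm1.preservesSectors_hamiltonian (fermionTorusGraph 2 L) t U)

end Torus
/-! ### The crux-facing form (classical instances, exactly as the route file elaborates them) -/

section CruxFacing

/-- The tracial ground-state functional does not depend on the `DecidableEq` instance used to
build it (instances are subsingletons) — needed because the route file `Theses/LogColdTorus.lean`
elaborates the `DecidableEq` instance of the occupation-block index type classically
(`open scoped Classical`), while `hubbardTorus_groundStateFunctional_toBlock_eq_traceAverage` above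
carries the structural instance. [folklore] -/
theorem groundStateFunctional_congr_decEq {m : Type*} [Fintype m] (d₁ d₂ : DecidableEq m)
    (A O : Matrix m m ℂ) :
    @Matrix.groundStateFunctional m _ d₁ A O = @Matrix.groundStateFunctional m _ d₂ A O := by
  rw [Subsingleton.elim d₁ d₂]

open Literature.Probability.LatticeModels
open scoped Matrix Classical

set_option synthInstance.maxSize 128 in
/-- **The crux's block vocabulary = the projector vocabulary (crux-facing form).** Verbatim the
statement of `hubbardTorus_groundStateFunctional_toBlock_eq_traceAverage`, but elaborated under
`open scoped Classical` with the default instance budget — i.e. with exactly the (classical)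
`DecidableEq` instance of the block index type that the route files `Theses/LogColdTorus.lean` /
`Theses/AbelianDuality.lean` produce — so that it REWRITES the window hypothesis of
`LogColdTorus.AverageToEvery` at `(U, L)` (with `n = ⌊(1-δ)L²/2⌋ ≤ L²`, i.e. `δ ≥ -1`) into the
ground-projector average bound `c L⁴ ≤ re ((tr P)⁻¹ tr (P Δ_d† Δ_d))` of route `BalabanIR` by a
plain `rw` (checked in the lead's scratch `DictTwin.lean`). Lieb, PRL 62 (1989) 1201; Tasaki (2020)
§2.1. [folklore] -/
theorem hubbardTorus_blockGroundStateFunctional_eq_traceAverage :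
    ∀ (L : ℕ) (t U : ℝ) (n : ℕ), n ≤ L ^ 2 →
    ∀ (O : Matrix (Finset (Orb (FermionTorus 2 L))) (Finset (Orb (FermionTorus 2 L))) ℂ),
    ((hubbardTorus 2 L t U).toBlock (fun s : Finset (Orb (FermionTorus 2 L)) => s.card = 2 * n ∧
          2 * (s.filter fun i => (ofLex i).2 = 0).card = 2 * n)
        (fun s : Finset (Orb (FermionTorus 2 L)) => s.card = 2 * n ∧
          2 * (s.filter fun i => (ofLex i).2 = 0).card = 2 * n)).groundStateFunctional
      (O.toBlock (fun s : Finset (Orb (FermionTorus 2 L)) => s.card = 2 * n ∧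
          2 * (s.filter fun i => (ofLex i).2 = 0).card = 2 * n)
        (fun s : Finset (Orb (FermionTorus 2 L)) => s.card = 2 * n ∧
          2 * (s.filter fun i => (ofLex i).2 = 0).card = 2 * n)) =
      ((projMatrix ((szSector (2 * n) 0 ⊓ Module.End.eigenspace (Matrix.toLin' (hubbardTorus 2 L t U))
          ((((hubbardTorus 2 L t U).minEnergyOn (szSector (2 * n) 0)) : ℝ) : ℂ)).map
          (Fock.toEuclidean (ι := Orb (FermionTorus 2 L)) :
            Fock (Orb (FermionTorus 2 L)) →ₗ[ℂ] EuclideanSpace ℂ (Finset (Orb (FermionTorus 2 L)))))).trace)⁻¹ *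
      (projMatrix ((szSector (2 * n) 0 ⊓ Module.End.eigenspace (Matrix.toLin' (hubbardTorus 2 L t U))
          ((((hubbardTorus 2 L t U).minEnergyOn (szSector (2 * n) 0)) : ℝ) : ℂ)).map
          (Fock.toEuclidean (ι := Orb (FermionTorus 2 L)) :
            Fock (Orb (FermionTorus 2 L)) →ₗ[ℂ] EuclideanSpace ℂ (Finset (Orb (FermionTorus 2 L))))) *
        O).trace := by
  intro L t U n hn O
  have key := hubbardTorus_groundStateFunctional_toBlock_eq_traceAverage L t U n hn O
  exact (groundStateFunctional_congr_decEq _ _ _ _).trans key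

end CruxFacing

end Summit.HubbardSuperconductivity.HubbardSuperconductivity.Theorems

end
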